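import Mathlib

/-!
# `SnSubsetDichotomy.ThresholdSubsetTriples` — stub `stub_cayleyDeletion` via Mathlib's graph API

Crux `stmt-MatrixMultiplication-10882`, registered stub `stub_cayleyDeletion`: for finite
`K, B ⊆ S_n` there is `X ⊆ K` avoiding `B` as a right quotient (`x x'⁻¹ ∈ B ⇒ x = x'` on `X`) with
`|K| ≤ (2|B| + 1)|X|`.

This file proves it through Mathlib's `SimpleGraph` vocabulary (independent sets versus maximum
degree), in two reusable steps:

* `exists_isIndepSet_card_le` — in a finite simple graph `G`, every finset `K` of vertices contains
  an independent set `X` (`SimpleGraph.IsIndepSet`) with `|K| ≤ (G.maxDegree + 1)·|X|`: an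
  inclusion-maximal independent subset of `K` (`Finset.exists_maximal`, Mathlib's `Maximal`)
  dominates `K`, and closed neighbourhoods have at most `maxDegree + 1` vertices
  (`Finset.card_biUnion_le_card_mul`, `SimpleGraph.degree_le_maxDegree`).
* the quotient graph of `B` is Mathlib's Cayley graph `SimpleGraph.mulCayley ↑B` pulled back along
  inversion (`SimpleGraph.comap`); its adjacency is `x ≠ x' ∧ (x x'⁻¹ ∈ B ∨ x' x⁻¹ ∈ B)`
  (`comap_inv_mulCayley_adj`, from `SimpleGraph.mulCayley_adj`) and its degrees are `≤ 2|B|`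
  (`degree_comap_inv_mulCayley_le`).

An independent set of the quotient graph is exactly a set avoiding `B` as a right quotient, which is
the stub (`stub_cayleyDeletion`).  A max-cardinality variant of the same statement for an arbitrary
group is `CayleyDeletion.exists_subset_avoiding_quotients` in the sibling file
`Theorems/SnSubsetDichotomyThresholdSubsetTriplesStubCayleyDeletion.lean`; the graph lemma here is
the general fact behind both.
-/

namespace Summit.MatrixMultiplication.MatrixMultiplication.Theorems.ThresholdSubsetTriples.ViaMaxDegree

open Finset SimpleGraph

/-- **Independent sets versus maximum degree.**  In a finite simple graph `G`, every finset `K` of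
vertices contains an independent set `X` with `K.card ≤ (G.maxDegree + 1) * X.card`: an
inclusion-maximal independent `X ⊆ K` dominates `K` (every `k ∈ K` is in `X` or adjacent to a vertex
of `X`), and each closed neighbourhood has at most `G.maxDegree + 1` vertices. [folklore] -/
theorem exists_isIndepSet_card_le {V : Type*} [Fintype V] [DecidableEq V] (G : SimpleGraph V)
    [DecidableRel G.Adj] (K : Finset V) :
    ∃ X ⊆ K, G.IsIndepSet ↑X ∧ K.card ≤ (G.maxDegree + 1) * X.card := by
  -- an inclusion-maximal independent subset of `K`
  obtain ⟨X, hX⟩ := (K.powerset.filter fun X : Finset V => G.IsIndepSet ↑X).exists_maximal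
    ⟨∅, by simp⟩
  have hXK : X ⊆ K := mem_powerset.1 (mem_filter.1 hX.1).1
  have hXi : G.IsIndepSet ↑X := (mem_filter.1 hX.1).2
  refine ⟨X, hXK, hXi, ?_⟩
  -- domination: `K` is covered by the closed neighbourhoods of the vertices of `X`
  have hdom : K ⊆ X.biUnion fun x => insert x (G.neighborFinset x) := by
    intro k hk
    by_contra hkn
    have hfar : ∀ x ∈ X, k ≠ x ∧ ¬G.Adj x k := fun x hx =>
      ⟨fun h => hkn (mem_biUnion.2 ⟨x, hx, h ▸ mem_insert_self _ _⟩),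
        fun h => hkn (mem_biUnion.2 ⟨x, hx, mem_insert_of_mem ((mem_neighborFinset _ _ _).2 h)⟩)⟩
    -- otherwise `insert k X` is again independent, contradicting the maximality of `X`
    have hins : insert k X ∈ K.powerset.filter fun X : Finset V => G.IsIndepSet ↑X := by
      rw [mem_filter, mem_powerset, coe_insert]
      exact ⟨insert_subset hk hXK,
        hXi.insert fun x hx _ => ⟨fun h => (hfar x hx).2 h.symm, (hfar x hx).2⟩⟩
    exact (hfar k (hX.2 hins (subset_insert k X) (mem_insert_self k X))).1 rfl
  calc K.card ≤ (X.biUnion fun x => insert x (G.neighborFinset x)).card := card_le_card hdom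
    _ ≤ X.card * (G.maxDegree + 1) := by
        refine card_biUnion_le_card_mul _ _ _ fun x _ => ?_
        calc (insert x (G.neighborFinset x)).card ≤ (G.neighborFinset x).card + 1 :=
              card_insert_le _ _
          _ ≤ G.maxDegree + 1 := by
              rw [card_neighborFinset_eq_degree]
              exact Nat.add_le_add_right (G.degree_le_maxDegree x) 1
    _ = (G.maxDegree + 1) * X.card := mul_comm _ _

/-- Adjacency in the **quotient graph** of `B` — Mathlib's Cayley graph `SimpleGraph.mulCayley ↑B`
pulled back along inversion: `x ~ x'` iff `x ≠ x'` and one of the two quotients `x x'⁻¹`, `x' x⁻¹`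
lies in `B`. -/
theorem comap_inv_mulCayley_adj {G : Type*} [Group G] (B : Finset G) (x x' : G) :
    ((SimpleGraph.mulCayley (↑B : Set G)).comap fun y => y⁻¹).Adj x x' ↔
      x ≠ x' ∧ (x * x'⁻¹ ∈ B ∨ x' * x⁻¹ ∈ B) := by
  simp [SimpleGraph.mulCayley_adj]

/-- Every vertex of the quotient graph of `B` has at most `2 * B.card` neighbours: a neighbour `x'`
of `x` is `b⁻¹ * x` or `b * x` for some `b ∈ B`. -/
theorem degree_comap_inv_mulCayley_le {G : Type*} [Group G] [Fintype G] [DecidableEq G]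
    (B : Finset G) [DecidableRel ((SimpleGraph.mulCayley (↑B : Set G)).comap fun y => y⁻¹).Adj]
    (x : G) : ((SimpleGraph.mulCayley (↑B : Set G)).comap fun y => y⁻¹).degree x ≤ 2 * B.card := by
  have hsub : ((SimpleGraph.mulCayley (↑B : Set G)).comap fun y => y⁻¹).neighborFinset x ⊆
      B.image (fun b => b⁻¹ * x) ∪ B.image (fun b => b * x) := by
    intro x' hx'
    rw [mem_neighborFinset, comap_inv_mulCayley_adj] at hx'
    rcases hx'.2 with h | h
    · exact mem_union_left _ (mem_image.2 ⟨_, h, by simp⟩)   -- `x' = (x x'⁻¹)⁻¹ * x`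
    · exact mem_union_right _ (mem_image.2 ⟨_, h, by simp⟩)  -- `x' = (x' x⁻¹) * x`
  rw [← card_neighborFinset_eq_degree]
  calc _ ≤ (B.image (fun b => b⁻¹ * x) ∪ B.image (fun b => b * x)).card := card_le_card hsub
    _ ≤ (B.image (fun b => b⁻¹ * x)).card + (B.image (fun b => b * x)).card := card_union_le _ _
    _ ≤ B.card + B.card := Nat.add_le_add card_image_le card_image_le
    _ = 2 * B.card := (two_mul _).symm

/-- **Stub `stub_cayleyDeletion` — Cayley-graph deletion** (crux
`SnSubsetDichotomy.ThresholdSubsetTriples`, stmt-MatrixMultiplication-10882).  For finite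
`K, B ⊆ S_n` there is `X ⊆ K` avoiding `B` as a right quotient (`x x'⁻¹ ∈ B ⇒ x = x'` for
`x, x' ∈ X`) with `|K| ≤ (2|B| + 1)|X|`: an independent set of the quotient graph inside `K` given
by `exists_isIndepSet_card_le`, the maximum degree being `≤ 2|B|` by
`degree_comap_inv_mulCayley_le`. [folklore] -/
theorem stub_cayleyDeletion : ∀ (n : ℕ) (K B : Finset (Equiv.Perm (Fin n))), ∃ X ⊆ K, (∀ x ∈ X, ∀ x' ∈ X, x * x'⁻¹ ∈ B → x = x') ∧ K.card ≤ (2 * B.card + 1) * X.card := by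
  intro n K B
  classical
  obtain ⟨X, hXK, hXi, hcard⟩ :=
    exists_isIndepSet_card_le ((SimpleGraph.mulCayley (↑B : Set _)).comap fun y => y⁻¹) K
  refine ⟨X, hXK, fun x hx x' hx' hB => ?_, hcard.trans (Nat.mul_le_mul_right _ (Nat.succ_le_succ
    (maxDegree_le_of_forall_degree_le _ _ (degree_comap_inv_mulCayley_le B))))⟩
  by_contra hne
  exact hXi hx hx' hne ((comap_inv_mulCayley_adj B x x').2 ⟨hne, Or.inl hB⟩)

end Summit.MatrixMultiplication.MatrixMultiplication.Theorems.ThresholdSubsetTriples.ViaMaxDegree
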